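import Literature.NumberTheory.ConnesMoscovici2022.UVProlateEigenGreen
import HarnessLib

/-!
# Connes–Moscovici 2022, Thm 1.6 (i) on eigenvectors: a.e.-even eigenvectors of `W_sa` with distinct
# eigenvalues are orthogonal

Topic `Literature/NumberTheory/ConnesMoscovici2022`; sequel of `UVProlateEigenGreen.lean` (Green's
formula for an eigen-pair, boundary Wronskian limits).  PROVES `inner_eq_zero_of_even_eigen`:
for `W` with `IsProlateSA λ W` and a.e.-even eigenvectors `φ₁, φ₂` with real eigenvalues `μ₁ ≠ μ₂`,
`⟪φ₂, φ₁⟫ = 0` — the symmetry `⟨W φ₁, φ₂⟩ = ⟨φ₁, W φ₂⟩` of [ConnesMoscovici2022, Thm 1.6 (i)] on the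
even eigenvectors, by Green's formula on `(λ, ∞)` and `(0, λ)` with all boundary terms killed by the
boundary conditions (1.19) (one-sided limits of Cor 1.7 (i)), by the asymptotics of Cor 1.7 (ii) at `+∞`
(`CM22_cor_1_7_strong`) and by evenness at `0`.  RH-FREE; nothing here bears on the truth of RH.
-/

noncomputable section

open Complex Set MeasureTheory Filter Topology intervalIntegral
open scoped Real Topology ContDiff ComplexConjugate InnerProductSpace

namespace Literature.NumberTheory.ConnesMoscovici2022

open Literature.NumberTheory.ConnesConsani2024

variable {lam : ℝ}

/-- `S = ℝ ∖ {±λ}` is open (plumbing). [folklore] -/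
private theorem isOpen_S4 (lam : ℝ) : IsOpen {x : ℝ | x ≠ lam ∧ x ≠ -lam} := isOpen_ne.and isOpen_ne

/-! ## Orthogonality of even eigenvectors with distinct eigenvalues -/

section Orthogonality

open Literature.NumberTheory.ConnesConsani2021

/-- An a.e.-even function continuous off `±λ` is even off `±λ` (plumbing). [folklore] -/
private theorem even_of_ae₄ {g : ℝ → ℂ} (hgc : ContinuousOn g {x | x ≠ lam ∧ x ≠ -lam})
    (hae : ∀ᵐ x : ℝ, g (-x) = g x) : EqOn (fun x => g (-x)) g {x | x ≠ lam ∧ x ≠ -lam} := by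
  refine Measure.eqOn_open_of_ae_eq (ae_restrict_of_ae hae) (isOpen_S4 lam) ?_ hgc
  refine hgc.comp continuous_neg.continuousOn fun x hx => ?_
  simp only [mem_setOf_eq] at hx ⊢
  exact ⟨fun h => hx.2 (by linarith), fun h => hx.1 (by linarith)⟩

/-- The derivative of a function even off `±λ` and differentiable there vanishes at `0` (plumbing).
[folklore] -/
private theorem deriv_zero_of_even {g : ℝ → ℂ} (hlam : 0 < lam)
    (hsm : ContDiffOn ℝ ∞ g {x | x ≠ lam ∧ x ≠ -lam})
    (heven : EqOn (fun x => g (-x)) g {x | x ≠ lam ∧ x ≠ -lam}) : deriv g 0 = 0 := by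
  have hS := isOpen_S4 lam
  have h0S : (0 : ℝ) ∈ {x : ℝ | x ≠ lam ∧ x ≠ -lam} := ⟨by simp; exact hlam.ne, by simp; exact hlam.ne'⟩
  have hgd : HasDerivAt g (deriv g 0) 0 :=
    ((hsm.differentiableOn (by simp) 0 h0S).differentiableAt (hS.mem_nhds h0S)).hasDerivAt
  have hloc : g =ᶠ[𝓝 0] fun y => g (-y) := by
    filter_upwards [hS.mem_nhds h0S] with y hy
    exact (heven hy).symm
  have h1 : HasDerivAt (fun y => g (-y)) (-deriv g 0) 0 := by
    have h := (show HasDerivAt g (deriv g (-0)) (-0) by rw [neg_zero]; exact hgd).scomp 0 (hasDerivAt_neg 0)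
    rw [show (g ∘ fun y : ℝ => -y) = fun y => g (-y) from rfl] at h
    exact h.congr_deriv (by simp)
  have h2 : deriv g 0 = -deriv g 0 := hloc.deriv_eq.trans h1.deriv
  linear_combination h2 / 2

/-- Data package for an a.e.-even eigenvector (plumbing for the orthogonality theorem): the
boundary-condition representative with all the properties used below. [cite: ConnesMoscovici2022, Cor 1.7 (= arXiv:2112.05500 Cor 2.7, chunk p0006:L116–L123)] -/
private theorem even_eigen_package (hlam : 0 < lam) {W : L2R →ₗ.[ℂ] L2R} (hSA : IsProlateSA lam W)
    {μ : ℝ} {φ : L2R} (hev : W.HasEigenvector (μ : ℂ) φ)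
    (he : ∀ᵐ x : ℝ, (φ : ℝ → ℂ) (-x) = (φ : ℝ → ℂ) x) :
    ∃ g : ℝ → ℂ, (φ : ℝ → ℂ) =ᵐ[volume] g ∧ ContDiffOn ℝ ∞ g {x | x ≠ lam ∧ x ≠ -lam} ∧
      (∀ x ∈ {x : ℝ | x ≠ lam ∧ x ≠ -lam},
        HasDerivAt (fun y => pCoeff lam y * deriv g y) ((qCoeff lam x - μ) * g x) x) ∧
      EqOn (fun x => g (-x)) g {x | x ≠ lam ∧ x ≠ -lam} ∧
      Tendsto (fun x => pCoeff lam x * deriv g x) (𝓝[>] lam) (𝓝 0) ∧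
      Tendsto (fun x => pCoeff lam x * deriv g x) (𝓝[<] lam) (𝓝 0) ∧
      (∃ c, Tendsto g (𝓝[>] lam) (𝓝 c)) ∧ (∃ c, Tendsto g (𝓝[<] lam) (𝓝 c)) ∧
      ∃ A : ℂ, Tendsto (fun x : ℝ => (x : ℂ) * g x - A * (Real.sin (2 * π * lam * x) : ℂ)) atTop (𝓝 0) ∧
        Tendsto (fun x : ℝ => (g x + x * deriv g x) -
          ((2 * π * lam : ℝ) : ℂ) * A * (Real.cos (2 * π * lam * x) : ℂ)) atTop (𝓝 0) := by
  obtain ⟨g, hfg, hbc, hsm, hR, hL, -, -⟩ := CM22_cor_1_7_i_both lam hlam W hSA μ φ hev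
  obtain ⟨hφ, hW, -⟩ := exists_repr_of_hasEigenvector hSA hev
  have hS := isOpen_S4 lam
  have hu : ∀ x ∈ {x : ℝ | x ≠ lam ∧ x ≠ -lam},
      HasDerivAt (fun y => pCoeff lam y * deriv g y) ((qCoeff lam x - μ) * g x) x :=
    fun x hx => hasDerivAt_pCoeff_mul_deriv_repr hlam hφ hW hfg hbc.differentiableOn hx.1 hx.2
  have hae : ∀ᵐ x : ℝ, g (-x) = g x := by
    have h1 : (fun x => (φ : ℝ → ℂ) (-x)) =ᵐ[volume] fun x => g (-x) :=
      (Measure.measurePreserving_neg (volume : Measure ℝ)).quasiMeasurePreserving.ae_eq_comp hfg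
    filter_upwards [he, hfg, h1] with x h0 h2 h3
    rw [← h3, h0, h2]
  have heven := even_of_ae₄ hsm.continuousOn hae
  have hbcR : Tendsto (fun x => pCoeff lam x * deriv g x) (𝓝[>] lam) (𝓝 0) :=
    hbc.atLam.mono_left (nhdsWithin_mono _ fun x hx =>
      ⟨ne_of_gt hx, by intro h; rw [h] at hx; exact absurd hx (by simp; linarith)⟩)
  have hbcL : Tendsto (fun x => pCoeff lam x * deriv g x) (𝓝[<] lam) (𝓝 0) := by
    rw [← nhdsWithin_Ioo_eq_nhdsLT (neg_lt_self hlam)]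
    exact hbc.atLam.mono_left (nhdsWithin_mono _ fun x hx =>
      ⟨ne_of_lt hx.2, by intro h; rw [h] at hx; linarith [hx.1]⟩)
  -- BC (1.20) for g itself, then α₀ → 0, then the strong asymptotics
  have hT : Tendsto (bcInfEven lam g) atTop (𝓝 0) := by
    refine hbc.evenTop.congr' ?_
    filter_upwards [eventually_gt_atTop lam] with x hx
    have hxS : x ∈ {x : ℝ | x ≠ lam ∧ x ≠ -lam} :=
      ⟨ne_of_gt hx, by intro h; rw [h] at hx; exact absurd hx (by simp; linarith)⟩
    have h1 : evenFn g =ᶠ[𝓝 x] g := by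
      filter_upwards [hS.mem_nhds hxS] with y hy
      have := heven hy
      simp only at this
      rw [evenFn, this]; ring
    rw [bcInfEven, bcInfEven, h1.eq_of_nhds, h1.deriv_eq]
  have hw : ((2 * π * lam : ℝ) : ℂ) ≠ 0 := Complex.ofReal_ne_zero.2 (by positivity)
  have hα : Tendsto (fun x : ℝ => (Real.cos (2 * π * lam * x + 0) : ℂ) * (x * g x) -
      (Real.sin (2 * π * lam * x + 0) : ℂ) * (g x + x * deriv g x) / (2 * π * lam)) atTop (𝓝 0) := by
    have h := hT.const_mul (-((2 * π * lam : ℝ) : ℂ))⁻¹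
    rw [mul_zero] at h
    refine h.congr fun x => ?_
    rw [bcInfEven_eq_osc lam hlam g x, ← mul_assoc, inv_mul_cancel₀ (neg_ne_zero.2 hw), one_mul]
  obtain ⟨A, h1, h2⟩ := exists_tendsto_v_sub_of_osc_tendsto_zero hlam μ 0 hsm hu hα
  refine ⟨g, hfg, hsm, hu, heven, hbcR, hbcL, hR, hL, A, ?_, ?_⟩
  · simpa only [add_zero] using h1
  · simpa only [add_zero] using h2

/-- `g₁ ḡ₂` is integrable for representatives of two `L²` classes (plumbing). [folklore] -/
private theorem integrable_mul_conj_repr {φ₁ φ₂ : L2R} {g₁ g₂ : ℝ → ℂ}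
    (hfg₁ : (φ₁ : ℝ → ℂ) =ᵐ[volume] g₁) (hfg₂ : (φ₂ : ℝ → ℂ) =ᵐ[volume] g₂) :
    Integrable (fun x => g₁ x * conj (g₂ x)) := by
  have h := L2.integrable_inner (𝕜 := ℂ) φ₂ φ₁
  refine h.congr ?_
  filter_upwards [hfg₁, hfg₂] with x h1 h2
  rw [RCLike.inner_apply, h1, h2, mul_comm]

/-- **Orthogonality of a.e.-even eigenvectors of `W_sa` with distinct eigenvalues** (symmetry of
`W_sa` on its even eigenvectors): Green's formula on `(λ, ∞)` and `(0, λ)`, all boundary terms killed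
by (1.19) (with the one-sided limits of Cor 1.7 (i)), by the asymptotics of Cor 1.7 (ii) at `+∞`, and by
evenness at `0`; evenness reflects the computation to `x < 0`.
[cite: ConnesMoscovici2022, Thm 1.6 (i) and (1.5)–(1.7) (= arXiv:2112.05500 Thm 2.6 (i), (2.5)–(2.7), chunk p0005:L24–L40, p0006:L76)] -/
theorem inner_eq_zero_of_even_eigen (lam : ℝ) (hlam : 0 < lam) {W : L2R →ₗ.[ℂ] L2R}
    (hSA : IsProlateSA lam W) {μ₁ μ₂ : ℝ} (hne : μ₁ ≠ μ₂) {φ₁ φ₂ : L2R}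
    (hev₁ : W.HasEigenvector (μ₁ : ℂ) φ₁) (hev₂ : W.HasEigenvector (μ₂ : ℂ) φ₂)
    (he₁ : ∀ᵐ x : ℝ, (φ₁ : ℝ → ℂ) (-x) = (φ₁ : ℝ → ℂ) x)
    (he₂ : ∀ᵐ x : ℝ, (φ₂ : ℝ → ℂ) (-x) = (φ₂ : ℝ → ℂ) x) :
    ⟪φ₂, φ₁⟫_ℂ = 0 := by
  have hS := isOpen_S4 lam
  obtain ⟨g₁, hfg₁, hsm₁, hu₁, hev_g₁, hbcR₁, hbcL₁, ⟨cR₁, hcR₁⟩, ⟨cL₁, hcL₁⟩, A₁, hv₁, hv₁'⟩ :=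
    even_eigen_package hlam hSA hev₁ he₁
  obtain ⟨g₂, hfg₂, hsm₂, hu₂, hev_g₂, hbcR₂, hbcL₂, ⟨cR₂, hcR₂⟩, ⟨cL₂, hcL₂⟩, A₂, hv₂, hv₂'⟩ :=
    even_eigen_package hlam hSA hev₂ he₂
  set F : ℝ → ℂ := fun x => g₁ x * conj (g₂ x) with hF
  set Wr : ℝ → ℂ := fun x => conj (pCoeff lam x * deriv g₂ x) * g₁ x - pCoeff lam x * deriv g₁ x * conj (g₂ x)
    with hWr
  have hFint : Integrable F := integrable_mul_conj_repr hfg₁ hfg₂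
  have hFii : ∀ a b : ℝ, IntervalIntegrable F volume a b := fun a b => hFint.intervalIntegrable
  have hprim : Continuous fun b => ∫ x in lam..b, F x := continuous_primitive hFii lam
  have hprim0 : Continuous fun b => ∫ x in (0:ℝ)..b, F x := continuous_primitive hFii 0
  set d : ℂ := ((μ₁ - μ₂ : ℝ) : ℂ) with hd
  have hd0 : d ≠ 0 := by rw [hd]; exact Complex.ofReal_ne_zero.2 (sub_ne_zero.2 hne)
  -- Green on [a, b] ⊂ (λ, ∞) and on [0, b] ⊂ [0, λ)
  have hgreen : ∀ a b : ℝ, uIcc a b ⊆ {x : ℝ | x ≠ lam ∧ x ≠ -lam} →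
      d * ∫ x in a..b, F x = Wr b - Wr a := fun a b hab =>
    green_mixed lam μ₁ μ₂ hsm₁ hsm₂ hu₁ hu₂ hab
  -- Step 1 (outside): d ∫_λ^b F = 𝒲 b for b > λ
  have hout : ∀ b, lam < b → d * ∫ x in lam..b, F x = Wr b := by
    intro b hb
    have hWa : Tendsto Wr (𝓝[>] lam) (𝓝 0) := tendsto_mixed_wronskian_of_bc hbcR₁ hbcR₂ hcR₁ hcR₂
    have hI : Tendsto (fun a => d * ∫ x in a..b, F x) (𝓝[>] lam) (𝓝 (d * ∫ x in lam..b, F x)) := by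
      have hc : Continuous fun a => ∫ x in a..b, F x := by
        have : (fun a => ∫ x in a..b, F x) = fun a => (∫ x in lam..b, F x) - ∫ x in lam..a, F x := by
          funext a
          rw [eq_sub_iff_add_eq, add_comm, intervalIntegral.integral_add_adjacent_intervals (hFii _ _) (hFii _ _)]
        rw [this]; exact continuous_const.sub hprim
      exact ((hc.tendsto lam).mono_left nhdsWithin_le_nhds).const_mul d
    have hI' : Tendsto (fun a => d * ∫ x in a..b, F x) (𝓝[>] lam) (𝓝 (Wr b - 0)) := by
      refine (tendsto_const_nhds.sub hWa).congr' ?_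
      filter_upwards [Ioo_mem_nhdsGT hb] with a ha
      rw [hgreen a b (by rw [uIcc_of_le ha.2.le]; exact fun x hx =>
        ⟨by intro h; rw [h] at hx; linarith [hx.1, ha.1], by intro h; rw [h] at hx; linarith [hx.1, ha.1]⟩)]
    rw [sub_zero] at hI'
    exact tendsto_nhds_unique hI hI'
  have hIoi : d * ∫ x in Ioi lam, F x = 0 := by
    have h1 : Tendsto (fun b => d * ∫ x in lam..b, F x) atTop (𝓝 (d * ∫ x in Ioi lam, F x)) :=
      (intervalIntegral_tendsto_integral_Ioi lam hFint.integrableOn tendsto_id).const_mul d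
    have h2 : Tendsto (fun b => d * ∫ x in lam..b, F x) atTop (𝓝 0) := by
      refine (tendsto_mixed_wronskian_atTop hv₁ hv₁' hv₂ hv₂').congr' ?_
      filter_upwards [eventually_gt_atTop lam] with b hb
      exact (hout b hb).symm
    exact tendsto_nhds_unique h1 h2
  -- Step 2 (inside): d ∫_0^λ F = 0
  have hW0 : Wr 0 = 0 := by
    rw [hWr]; dsimp only
    rw [deriv_zero_of_even hlam hsm₁ hev_g₁, deriv_zero_of_even hlam hsm₂ hev_g₂]
    simp
  have hin : d * ∫ x in (0:ℝ)..lam, F x = 0 := by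
    have hWb : Tendsto Wr (𝓝[<] lam) (𝓝 0) := tendsto_mixed_wronskian_of_bc hbcL₁ hbcL₂ hcL₁ hcL₂
    have hI : Tendsto (fun b => d * ∫ x in (0:ℝ)..b, F x) (𝓝[<] lam) (𝓝 (d * ∫ x in (0:ℝ)..lam, F x)) :=
      ((hprim0.tendsto lam).mono_left nhdsWithin_le_nhds).const_mul d
    have hI' : Tendsto (fun b => d * ∫ x in (0:ℝ)..b, F x) (𝓝[<] lam) (𝓝 (0 - Wr 0)) := by
      refine (hWb.sub tendsto_const_nhds).congr' ?_
      filter_upwards [Ioo_mem_nhdsLT hlam] with b hb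
      rw [hgreen 0 b (by rw [uIcc_of_le hb.1.le]; exact fun x hx =>
        ⟨by intro h; rw [h] at hx; linarith [hx.2, hb.2], by intro h; rw [h] at hx; linarith [hx.1]⟩)]
    rw [hW0, sub_zero] at hI'
    exact tendsto_nhds_unique hI hI'
  -- Step 3: ∫_ℝ F = 2 (∫_0^λ F + ∫_{Ioi λ} F)
  have hFeven : ∀ᵐ x : ℝ, F (-x) = F x := by
    have hnull : ∀ᵐ x : ℝ, x ≠ lam ∧ x ≠ -lam := by
      have h1 : ∀ᵐ x : ℝ, x ≠ lam := by rw [ae_iff]; simp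
      have h2 : ∀ᵐ x : ℝ, x ≠ -lam := by rw [ae_iff]; simp
      exact h1.and h2
    filter_upwards [hnull] with x hx
    rw [hF]; dsimp only
    have e1 := hev_g₁ hx; have e2 := hev_g₂ hx
    simp only at e1 e2
    rw [e1, e2]
  have hsplit_pos : ∫ x in Ioi (0:ℝ), F x = (∫ x in (0:ℝ)..lam, F x) + ∫ x in Ioi lam, F x := by
    rw [intervalIntegral.integral_of_le hlam.le, ← Ioc_union_Ioi_eq_Ioi hlam.le,
      setIntegral_union (Set.disjoint_left.2 fun t (ht : t ∈ Ioc 0 lam) (ht' : t ∈ Ioi lam) =>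
        (not_lt.2 ht.2) ht') measurableSet_Ioi hFint.integrableOn hFint.integrableOn]
  have hneg : ∫ x in Iic (0:ℝ), F x = ∫ x in Ioi (0:ℝ), F x := by
    have h := integral_comp_neg_Ioi 0 F
    rw [neg_zero] at h
    rw [← h]
    refine setIntegral_congr_ae measurableSet_Ioi ?_
    filter_upwards [hFeven] with x hx _
    exact hx
  have htotal : ∫ x, F x = 2 * ((∫ x in (0:ℝ)..lam, F x) + ∫ x in Ioi lam, F x) := by
    rw [← setIntegral_univ, ← Iic_union_Ioi (a := (0:ℝ)),
      setIntegral_union (Set.disjoint_left.2 fun t (ht : t ∈ Iic (0:ℝ)) (ht' : t ∈ Ioi (0:ℝ)) =>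
        absurd (show (0:ℝ) < t from ht') (not_lt.2 (show t ≤ 0 from ht))) measurableSet_Ioi
        hFint.integrableOn hFint.integrableOn, hneg, hsplit_pos]
    ring
  -- Step 4: conclude
  have hint0 : ∫ x, F x = 0 := by
    have : d * ∫ x, F x = 0 := by
      rw [htotal]
      linear_combination (2:ℂ) * hin + (2:ℂ) * hIoi
    exact (mul_eq_zero.1 this).resolve_left hd0
  rw [L2.inner_def]
  have : (fun a : ℝ => ⟪(φ₂ : ℝ → ℂ) a, (φ₁ : ℝ → ℂ) a⟫_ℂ) =ᵐ[volume] F := by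
    filter_upwards [hfg₁, hfg₂] with x h1 h2
    simp only [RCLike.inner_apply, h1, h2, hF]
  rw [integral_congr_ae this, hint0]

end Orthogonality

end Literature.NumberTheory.ConnesMoscovici2022
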